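import Literature.AnabelianGeometry.EtaleTheta.ThetaCoversAxOfSetting
import Literature.AnabelianGeometry.EtaleTheta.ThetaCoversTempered
import Literature.AnabelianGeometry.EtaleTheta.Discharge.Sec2Def21OfSetting
import Literature.AnabelianGeometry.EtaleTheta.Discharge.Sec2Def23OfSplitting
import Literature.AnabelianGeometry.EtaleTheta.Discharge.Sec2Prop22InvThetaOfInvEll
import Literature.AnabelianGeometry.EtaleTheta.Discharge.Sec2PiCTemperedSide
import HarnessLib

/-!
# [EtTh] §2 AT THE §1 MODEL: an inhabitant of `ThetaCovers.TemperedCoverData` — the coverings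
# `X̲̲, C̲̲, Y, Ÿ, Ċ` of `C` through `Π^tp_C ↪ Π_C` (W3-L2-02 «§2 COVER/ORBIT MODEL», the assembly)

Mochizuki, *The étale theta function and its Frobenioid-theoretic manifestations*, Publ. RIMS **45**
(2009), §2: Def. 2.1 p. 36, Prop. 2.2 pp. 36–38, Def. 2.3 p. 38, Prop. 2.4 p. 38, Def. 2.5 p. 39
(printed 262–265) [cite: MochizukiEtTh2009, Def 2.3 p.38].

Cell abc-iut, layer L2, W3-L2-02 (seat abc-iut-L2-d3). Post-freeze class (b) MODEL / CONSTRUCTION file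
(L2-lead 2026-08-26T04:46:23Z (B)(3)(b)). abc-iut-L2-t2's record `ThetaCovers.TemperedCoverData l`
(ThetaCoversTempered.lean v2; profinite part `CoverDataAx` over the REPAIRED `CoverData` v3) had no
inhabitant over the arithmetic [EtTh] data (finding F1 / GAP-LEDGER G-L2d3-5, now repaired). This file
ASSEMBLES one from the §1 model:

* profinite part `:=` abc-iut-L2-t10's `PiCData.coverDataAx` (ThetaCoversAxOfSetting, p428054) over the
  `PiCData` `I := e.piCDataOf ιC hιC` of `MuTwoSettingPiCData` (`Π_C :=` a profinite completion `P_C` of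
  `Π^tp_C`, `Π_X ↪ Π_C ↠ G_K`), `hιtheta` derived from `hιell` (`PiCData.inv_theta_of_inv_ell`,
  abc-iut-L6-d6 / w5-d057 lineage);
* `Π_C̲̲ := S·E·⟨ι₀⟩` — `exists_PiCuu_ofSetting`: the Def. 2.3 datum EXISTS and is OPEN, from the model's
  `Π_C̲ := cl(ιC(inclX(Π^tp_X̲)))·⟨c⟩` of type `(1, l-tors)±` and inversion `c` (`Sec2Def21OfSetting`:
  `isTypeLTorsPm_ofSetting`, `isInversion_ofSetting` below) and a CLOSED splitting `S` of `D̄_x ↠ G_K`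
  (`Sec2Def23OfSplitting.exists_isTypeLTorsThetaPm_isOpen`);
* tempered part: `Gtp := Π^tp_C`, `toHat := ιC`, `Π^tp_Y := inclX(Ker toZ)`, `Π^tp_Ÿ := inclX(Π^tp_Ÿ)`,
  `Π^tp_Ċ := dotC ε_Z` for an admissible `ε_Z` (abc-iut-L2-t1 `exists_isAdmissibleEpsZ`), with the field
  proofs of `Sec2PiCTemperedSide`;
* `temperedCoverData … : TemperedCoverData l` and its specialisation `temperedCoverDataHat` to THE
  completion `e.toPiCHat` of `MuTwoSettingPiCData`.

v2 (gen 5, PINNING `X̲`): v1 chose `Π_C̲̲` by `Classical.choose` from an existence statement that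
forgot the clause `Π_C̲̲ ∩ Π_X ⊆ Π_X̲`, so the `X̲`-member `T.PiXu` of the assembled cover was NOT provably
print's `Π_X̲ = cl(ιC(inclX(Π^tp_X̲)))` (the covering defined by `Π^tp_X ↠ Z ↠ Z/l`; an `l`-torsion-LINE
ambiguity of the abstract type `(1, l-tors)`), and Def. 2.5 (i)(a) "`Π^tp_Y ⊆ Π^tp_X̲`" was undecidable
for it. v2 chooses from `exists_PiCuu_ofSetting'`, which records `(Π_C̲̲ ∩ Π_X)·Δ̄_Θ-preimage = Π_X̲`
(`CoverDataAx.splitting_sup_eigen_sup_barTheta`: `S·E·Δ̄_Θ-preimage = Π_X̲`, Prop. 2.2 (ii)), and PROVES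
the identifications consumers need: `temperedCoverData_PiXu` (`T.PiXu = cl(ιC(inclX(Π^tp_X̲)))`),
`temperedCoverData_tp_PiXu` (`Π^tp` of `X̲` IS `inclX(Π^tp_X̲)`; `Π^tp` of `X` IS `inclX(Π^tp_X)` is
`Discharge/Sec2CuspStabModel.temperedCoverData_tp_PiX`), `temperedCoverData_PiYtp_le_tp_PiXu` (Def. 2.5
(i)(a) HOLDS at the model); plus the specialisation `temperedCoverDataHat` to THE completion `e.toPiCHat`. v1's decls are
kept with unchanged statements (`exists_PiCuu_ofSetting` verbatim; the `def` body re-pointed).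

HONEST RESIDUE — the named hypothesis BINDERS (no new `Prop` fact; GAP-LEDGER / census W3-L2-02):
`op : OncePuncturedData` (abc-iut-L2-t7: cusps, (P1)–(P5)); P-C3 `hIx` "`I_x ⥲ Δ̄_Θ`" (G-L2t10-3); P-C4
`hιell` "`ι` acts by `−1` on `Δ̄^ell_X`" (G-L2t10-4 (a)); P-C6 a CLOSED SPLITTING `S` of `D̄_x ↠ G_K`
(`IsSplitting S ∧ IsClosed S`: the `K`-rational cusp gives a continuous section — not derivable for an
abstract profinite `G_K`); P-C7 the TEMPERED normalities `inclX(Π^tp_X̲) ⊴ Π^tp_C` (`hN`) and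
`inclX(Π^tp_Y) ⊴ Π^tp_C` (`hY`) — both dischargeable from the printed definition of `Z`
(`Thm16Sub.KerToZIsCompactlyGenerated`: abc-iut-L6-t19 `map_inclX_GtpXu_normal`,
`CLevelData.map_inclX_GtpY_normal`). Nothing asserts that a `MuTwoSetting` exists; no side is taken on
[IUTchIII] Cor. 3.12; typed ≠ proved.
-/

noncomputable section

namespace Literature.AnabelianGeometry.EtaleTheta

open Literature.AnabelianGeometry.SemiGraphs ThetaCovers
open _root_.Topology

namespace MuTwoSetting.CLevelData

variable {p : ℕ} [Fact p.Prime] {M : MuTwoSetting p}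
variable {PC : Type} [Group PC] [TopologicalSpace PC] [IsTopologicalGroup PC] [T2Space PC]

/-! ### `Π_C̲ := Π_X̲·⟨c⟩` is of type `(1, l-tors)±`, `c` is an inversion -/

/-- Packaging of abc-iut-L2-t2's `IsTypeLTorsPm` over ANY `X : CoverDataAx l`: if `H = Π_X̲ ⊴ Π_C` is of type
`(1, l-tors)` and `c ∉ Π_X` has `c² ∈ H`, then `Π_C̲ := H·⟨c⟩` is of type `(1, l-tors)±`
(`Π_C̲ ∩ Π_X = H` of index `2` in `Π_C̲`). [cite: MochizukiEtTh2009, Def 2.1 p.36] -/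
theorem _root_.Literature.AnabelianGeometry.EtaleTheta.ThetaCovers.CoverDataAx.isTypeLTorsPm_sup_zpowers
    {l : ℕ} (X : CoverDataAx.{0} l) {H : Subgroup X.PiC} [hHn : H.Normal] (hT : X.toCoverData.IsTypeLTors H)
    {c : X.PiC} (hc2 : c * c ∈ H) (hcX : c ∉ X.PiX) :
    X.toCoverData.IsTypeLTorsPm (H ⊔ Subgroup.zpowers c) := by
  have hinf : (H ⊔ Subgroup.zpowers c) ⊓ X.PiX = H := sup_zpowers_inf_eq_of_sq_mem hT.le hc2 hcX
  have hcH : c ∉ H := fun h => hcX (hT.le h)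
  refine ⟨?_, ?_⟩
  · show X.toCoverData.IsTypeLTors ((H ⊔ Subgroup.zpowers c) ⊓ X.PiX)
    rw [hinf]
    exact hT
  · show ((H ⊔ Subgroup.zpowers c) ⊓ X.PiX).relIndex (H ⊔ Subgroup.zpowers c) = 2
    rw [hinf]
    exact relIndex_sup_zpowers_of_sq_mem hc2 hcH

/-- **Def. 2.1 at the model: `Π_X̲ := cl(ιC(inclX(Π^tp_X̲)))` is of type `(1, l-tors)`** for the cover
`(e.piCDataOf ιC hιC).coverDataAx …` (fields from `Sec2Def21OfSetting`). [cite: MochizukiEtTh2009, Def 2.1 p.36] -/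
theorem isTypeLTors_ofSetting (e : M.CLevelData) (ιC : M.GtpC →ₜ* PC) (hιC : IsProfiniteCompletion ιC)
    (op : M.toThetaSetting.OncePuncturedData) {l : ℕ} (hodd : Odd l) {x : M.Pt} (hx : M.IsCusp x)
    (hIx : ((e.piCDataOf ιC hιC).Dx x ⊓ (e.piCDataOf ιC hιC).augGK.ker) ⊔ (e.piCDataOf ιC hιC).barKer l =
      (e.piCDataOf ιC hιC).barTheta l)
    (hιell : ∀ c ∈ (e.piCDataOf ιC hιC).augGK.ker, c ∉ (e.piCDataOf ιC hιC).PiX →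
      ∀ d ∈ (e.piCDataOf ιC hιC).PiX ⊓ (e.piCDataOf ιC hιC).augGK.ker,
        c * d * c⁻¹ * d ∈ (e.piCDataOf ιC hιC).barTheta l) :
    ((e.piCDataOf ιC hιC).coverDataAx l op hx hodd hIx hιell
        ((e.piCDataOf ιC hιC).inv_theta_of_inv_ell l op hιell)).toCoverData.IsTypeLTors
      (((M.GtpXu l).map M.inclX).map ιC.toMonoidHom).topologicalClosure := by
  haveI : NeZero l := ⟨by obtain ⟨k, hk⟩ := hodd; omega⟩
  exact
    { le := e.closureXu_le_PiX ιC hιC l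
      quot := e.exists_quot_closureXu ιC hιC l
      barTheta_le := e.barTheta_le_closureXu ιC hιC op l
      delta_sup := e.closureXu_sup_deltaX ιC hιC l
      Dx_le := e.Dx_le_closureXu ιC hιC op l hx }

/-- **Def. 2.1 at the model: `Π_C̲ := cl(ιC(inclX(Π^tp_X̲)))·⟨c⟩` is of type `(1, l-tors)±`** for the cover
`(e.piCDataOf ιC hιC).coverDataAx …` and any `c ∈ Δ_C ∖ Π_X` (fields from `Sec2Def21OfSetting`;
`hN` = tempered normality of `Π^tp_X̲`). [cite: MochizukiEtTh2009, Def 2.1 p.36] -/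
theorem isTypeLTorsPm_ofSetting (e : M.CLevelData) (ιC : M.GtpC →ₜ* PC) (hιC : IsProfiniteCompletion ιC)
    (op : M.toThetaSetting.OncePuncturedData) {l : ℕ} (hodd : Odd l) {x : M.Pt} (hx : M.IsCusp x)
    (hIx : ((e.piCDataOf ιC hιC).Dx x ⊓ (e.piCDataOf ιC hιC).augGK.ker) ⊔ (e.piCDataOf ιC hιC).barKer l =
      (e.piCDataOf ιC hιC).barTheta l)
    (hιell : ∀ c ∈ (e.piCDataOf ιC hιC).augGK.ker, c ∉ (e.piCDataOf ιC hιC).PiX →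
      ∀ d ∈ (e.piCDataOf ιC hιC).PiX ⊓ (e.piCDataOf ιC hιC).augGK.ker,
        c * d * c⁻¹ * d ∈ (e.piCDataOf ιC hιC).barTheta l)
    (hN : ((M.GtpXu l).map M.inclX).Normal)
    {c : PC} (hc : c ∈ (e.piCDataOf ιC hιC).augGK.ker) (hcX : c ∉ (e.piCDataOf ιC hιC).PiX) :
    ((e.piCDataOf ιC hιC).coverDataAx l op hx hodd hIx hιell
        ((e.piCDataOf ιC hιC).inv_theta_of_inv_ell l op hιell)).toCoverData.IsTypeLTorsPm
      ((((M.GtpXu l).map M.inclX).map ιC.toMonoidHom).topologicalClosure ⊔ Subgroup.zpowers c) := by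
  exact CoverDataAx.isTypeLTorsPm_sup_zpowers (hHn := closureXu_normal ιC hιC l hN) _
    (e.isTypeLTors_ofSetting ιC hιC op hodd hx hIx hιell)
    (e.sq_mem_closureXu_of_inv_ell ιC hιC op hodd hιell hc hcX) hcX

/-- **`c ∈ Δ_C ∖ Π_X` is an inversion of `Π_C̲ := Π_X̲·⟨c⟩`** (`IsInversion`: `c ∈ Π_C̲`, `c ∈ Δ_C`, `c ∉ Π_X`).
[cite: MochizukiEtTh2009, Def 2.1 p.36] -/
theorem isInversion_ofSetting (e : M.CLevelData) (ιC : M.GtpC →ₜ* PC) (hιC : IsProfiniteCompletion ιC)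
    (op : M.toThetaSetting.OncePuncturedData) {l : ℕ} (hodd : Odd l) {x : M.Pt} (hx : M.IsCusp x)
    (hIx : ((e.piCDataOf ιC hιC).Dx x ⊓ (e.piCDataOf ιC hιC).augGK.ker) ⊔ (e.piCDataOf ιC hιC).barKer l =
      (e.piCDataOf ιC hιC).barTheta l)
    (hιell : ∀ c ∈ (e.piCDataOf ιC hιC).augGK.ker, c ∉ (e.piCDataOf ιC hιC).PiX →
      ∀ d ∈ (e.piCDataOf ιC hιC).PiX ⊓ (e.piCDataOf ιC hιC).augGK.ker,
        c * d * c⁻¹ * d ∈ (e.piCDataOf ιC hιC).barTheta l)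
    {c : PC} (hc : c ∈ (e.piCDataOf ιC hιC).augGK.ker) (hcX : c ∉ (e.piCDataOf ιC hιC).PiX) :
    ((e.piCDataOf ιC hιC).coverDataAx l op hx hodd hIx hιell
        ((e.piCDataOf ιC hιC).inv_theta_of_inv_ell l op hιell)).toCoverData.IsInversion
      ((((M.GtpXu l).map M.inclX).map ιC.toMonoidHom).topologicalClosure ⊔ Subgroup.zpowers c) c :=
  { mem := Subgroup.mem_sup_right (Subgroup.mem_zpowers c)
    mem_delta := hc
    not_mem := hcX }

/-! ### The Def 2.3 datum `Π_C̲̲` at the model -/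

/-- **`Π_C̲̲` EXISTS AND IS OPEN at the model**, granted a closed splitting `S` of `D̄_x ↠ G_K`: some
`P = S·E·⟨ι₀⟩ ⊇ S` is of type `(1, l-torsΘ)±` for the cover `(e.piCDataOf ιC hιC).coverDataAx …` and open
in `P_C` (`Sec2Def23OfSplitting.exists_isTypeLTorsThetaPm_isOpen` fed with `isTypeLTorsPm_ofSetting`,
`isInversion_ofSetting` and `exists_mem_ker_augGK_not_mem_PiX`). [cite: MochizukiEtTh2009, Def 2.3 p.38] -/
theorem exists_PiCuu_ofSetting (e : M.CLevelData) (ιC : M.GtpC →ₜ* PC) (hιC : IsProfiniteCompletion ιC)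
    (op : M.toThetaSetting.OncePuncturedData) {l : ℕ} (hodd : Odd l) {x : M.Pt} (hx : M.IsCusp x)
    (hIx : ((e.piCDataOf ιC hιC).Dx x ⊓ (e.piCDataOf ιC hιC).augGK.ker) ⊔ (e.piCDataOf ιC hιC).barKer l =
      (e.piCDataOf ιC hιC).barTheta l)
    (hιell : ∀ c ∈ (e.piCDataOf ιC hιC).augGK.ker, c ∉ (e.piCDataOf ιC hιC).PiX →
      ∀ d ∈ (e.piCDataOf ιC hιC).PiX ⊓ (e.piCDataOf ιC hιC).augGK.ker,
        c * d * c⁻¹ * d ∈ (e.piCDataOf ιC hιC).barTheta l)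
    (hN : ((M.GtpXu l).map M.inclX).Normal) {S : Subgroup PC}
    (hS : ((e.piCDataOf ιC hιC).coverDataAx l op hx hodd hIx hιell
        ((e.piCDataOf ιC hιC).inv_theta_of_inv_ell l op hιell)).toCoverData.IsSplitting S)
    (hSc : IsClosed (S : Set PC)) :
    ∃ P : Subgroup PC,
      ((e.piCDataOf ιC hιC).coverDataAx l op hx hodd hIx hιell
          ((e.piCDataOf ιC hιC).inv_theta_of_inv_ell l op hιell)).toCoverData.IsTypeLTorsThetaPm P ∧
        IsOpen (P : Set PC) ∧ S ≤ P := by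
  haveI : CompactSpace ((e.piCDataOf ιC hιC).coverDataAx l op hx hodd hIx hιell
      ((e.piCDataOf ιC hιC).inv_theta_of_inv_ell l op hιell)).PiC := hιC.compactSpace
  obtain ⟨c, hc, hcX⟩ := exists_mem_ker_augGK_not_mem_PiX (e.piCDataOf ιC hιC)
  obtain ⟨P, hP, hPo, hSP, -⟩ := CoverDataAx.exists_isTypeLTorsThetaPm_isOpen _
    (e.isTypeLTorsPm_ofSetting ιC hιC op hodd hx hIx hιell hN hc hcX)
    (e.isInversion_ofSetting ιC hιC op hodd hx hIx hιell hc hcX) hS hSc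
  exact ⟨P, hP, hPo, hSP⟩

/-- **`S·E·Δ̄_Θ-preimage = Π_X̲`** over ANY `X : CoverDataAx l` (Prop. 2.2 (ii): `Π_X̲ = D_x·E`, and a
splitting `S` covers `D_x` modulo `Δ̄_Θ`-preimage since `S ↠ G_K`): for `H'` of type `(1, l-tors)±`, `E` the
`(−1)`-eigenspace and `S` a splitting, `(S ⊔ E) ⊔ barTheta = H' ⊓ Π_X` (the identity inside abc-iut-L2-t2's
`index_typeLTorsTheta`, exported). [cite: MochizukiEtTh2009, Prop 2.2(ii) p.37] -/
theorem _root_.Literature.AnabelianGeometry.EtaleTheta.ThetaCovers.CoverDataAx.splitting_sup_eigen_sup_barTheta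
    {l : ℕ} (X : CoverDataAx.{0} l) {H' E S : Subgroup X.PiC} {ι : X.PiC}
    (hH' : X.toCoverData.IsTypeLTorsPm H') (hE : X.toCoverData.IsMinusEigen (H' ⊓ X.PiX) H' ι E)
    (hS : X.toCoverData.IsSplitting S) : (S ⊔ E) ⊔ X.barTheta = H' ⊓ X.PiX := by
  have hT := hH'.inf_isTypeLTors
  have hSle : S ≤ H' ⊓ X.PiX :=
    hS.le.trans (sup_le hT.Dx_le (X.barKer_le_barTheta.trans hT.barTheta_le))
  have hEle : E ≤ H' ⊓ X.PiX := hE.le.trans inf_le_left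
  refine le_antisymm (sup_le (sup_le hSle hEle) hT.barTheta_le) fun h hh => ?_
  obtain ⟨⟨s, hs⟩, hsh⟩ := hS.surj (X.aug h)
  have hsh : X.aug s = X.aug h := hsh
  have hy : s⁻¹ * h ∈ E ⊔ X.barTheta := by
    rw [hE.sup_eq]
    refine ⟨Subgroup.mul_mem _ (Subgroup.inv_mem _ (hSle hs)) hh, ?_⟩
    change s⁻¹ * h ∈ X.aug.ker
    rw [MonoidHom.mem_ker, map_mul, map_inv, hsh, inv_mul_cancel]
  have : h = s * (s⁻¹ * h) := by group
  rw [this]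
  exact Subgroup.mul_mem _ (Subgroup.mem_sup_left (Subgroup.mem_sup_left hs))
    ((sup_assoc S E X.barTheta).symm ▸ Subgroup.mem_sup_right hy)

/-- **`Π_C̲̲` EXISTS, IS OPEN, and is PINNED to `X̲`** (v2): as `exists_PiCuu_ofSetting`, with the extra clause
`(P ∩ Π_X)·Δ̄_Θ-preimage = Π_X̲ := cl(ιC(inclX(Π^tp_X̲)))` — the `X̲`-member below the chosen `C̲̲` IS the
covering of Def. 2.1 defined via `Z` (`P = S·E·⟨ι₀⟩` with `E` the `(−1)`-eigenspace inside THIS `Π_X̲`;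
`splitting_sup_eigen_sup_barTheta`, `sup_zpowers_inf_eq_of_sq_mem`). [cite: MochizukiEtTh2009, Def 2.3 p.38] -/
theorem exists_PiCuu_ofSetting' (e : M.CLevelData) (ιC : M.GtpC →ₜ* PC) (hιC : IsProfiniteCompletion ιC)
    (op : M.toThetaSetting.OncePuncturedData) {l : ℕ} (hodd : Odd l) {x : M.Pt} (hx : M.IsCusp x)
    (hIx : ((e.piCDataOf ιC hιC).Dx x ⊓ (e.piCDataOf ιC hιC).augGK.ker) ⊔ (e.piCDataOf ιC hιC).barKer l =
      (e.piCDataOf ιC hιC).barTheta l)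
    (hιell : ∀ c ∈ (e.piCDataOf ιC hιC).augGK.ker, c ∉ (e.piCDataOf ιC hιC).PiX →
      ∀ d ∈ (e.piCDataOf ιC hιC).PiX ⊓ (e.piCDataOf ιC hιC).augGK.ker,
        c * d * c⁻¹ * d ∈ (e.piCDataOf ιC hιC).barTheta l)
    (hN : ((M.GtpXu l).map M.inclX).Normal) {S : Subgroup PC}
    (hS : ((e.piCDataOf ιC hιC).coverDataAx l op hx hodd hIx hιell
        ((e.piCDataOf ιC hιC).inv_theta_of_inv_ell l op hιell)).toCoverData.IsSplitting S)
    (hSc : IsClosed (S : Set PC)) :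
    ∃ P : Subgroup PC,
      ((e.piCDataOf ιC hιC).coverDataAx l op hx hodd hIx hιell
          ((e.piCDataOf ιC hιC).inv_theta_of_inv_ell l op hιell)).toCoverData.IsTypeLTorsThetaPm P ∧
        IsOpen (P : Set PC) ∧ S ≤ P ∧
        (P ⊓ (e.piCDataOf ιC hιC).PiX) ⊔ (e.piCDataOf ιC hιC).barTheta l =
          (((M.GtpXu l).map M.inclX).map ιC.toMonoidHom).topologicalClosure := by
  set X := (e.piCDataOf ιC hιC).coverDataAx l op hx hodd hIx hιell
    ((e.piCDataOf ιC hιC).inv_theta_of_inv_ell l op hιell) with hXdef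
  haveI : CompactSpace X.PiC := hιC.compactSpace
  obtain ⟨c, hc, hcX⟩ := exists_mem_ker_augGK_not_mem_PiX (e.piCDataOf ιC hιC)
  have hT := e.isTypeLTors_ofSetting ιC hιC op hodd hx hIx hιell
  have hH' := e.isTypeLTorsPm_ofSetting ιC hιC op hodd hx hIx hιell hN hc hcX
  have hι := e.isInversion_ofSetting ιC hιC op hodd hx hIx hιell hc hcX
  haveI := closureXu_normal ιC hιC l hN
  have hHu : ((((M.GtpXu l).map M.inclX).map ιC.toMonoidHom).topologicalClosure ⊔ Subgroup.zpowers c) ⊓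
      (e.piCDataOf ιC hιC).PiX = (((M.GtpXu l).map M.inclX).map ιC.toMonoidHom).topologicalClosure :=
    sup_zpowers_inf_eq_of_sq_mem hT.le (e.sq_mem_closureXu_of_inv_ell ιC hιC op hodd hιell hc hcX) hcX
  obtain ⟨E, ι₀, hι₀, -, hE, hP⟩ := X.exists_isTypeLTorsThetaPm hH' hι hS
  refine ⟨(S ⊔ E) ⊔ Subgroup.zpowers ι₀, hP, X.isOpen_splitting_sup_eigen_sup_zpowers hH' hE hS hSc ι₀,
    le_sup_left.trans le_sup_left, ?_⟩
  have hSE := X.splitting_sup_eigen_sup_barTheta hH' hE hS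
  have hle : (S ⊔ E) ⊔ Subgroup.zpowers ι₀ ≤
      (((M.GtpXu l).map M.inclX).map ιC.toMonoidHom).topologicalClosure ⊔ Subgroup.zpowers c :=
    sup_le ((X.splitting_sup_eigen_le hH' hE hS).trans inf_le_left)
      ((Subgroup.zpowers_le (G := X.PiC)).2 hι₀.mem)
  refine le_antisymm ?_ ?_
  · -- `(P ∩ Π_X)·barTheta ≤ (H' ∩ Π_X)·barTheta = Π_X̲`
    rw [← hHu]
    exact sup_le (inf_le_inf_right _ hle) (hHu.symm ▸ hT.barTheta_le)
  · -- `Π_X̲ = H' ∩ Π_X = S·E·barTheta ≤ (P ∩ Π_X)·barTheta`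
    have hSE' : ((((M.GtpXu l).map M.inclX).map ιC.toMonoidHom).topologicalClosure ⊔ Subgroup.zpowers c) ⊓
        (e.piCDataOf ιC hιC).PiX ≤ (S ⊔ E) ⊔ (e.piCDataOf ιC hιC).barTheta l := hSE.ge
    have hPE : S ⊔ E ≤ ((S ⊔ E) ⊔ Subgroup.zpowers ι₀) ⊓ (e.piCDataOf ιC hιC).PiX :=
      le_inf le_sup_left ((X.splitting_sup_eigen_le hH' hE hS).trans inf_le_right)
    rw [← hHu]
    exact hSE'.trans (sup_le_sup_right hPE _)

/-! ### The assembly -/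

/-- **An inhabitant of `TemperedCoverData l` at the [EtTh] §1 model** (Def. 2.1 / 2.3 / Prop. 2.4 data of
`C = X/±1`): profinite part = abc-iut-L2-t10's `PiCData.coverDataAx` over `I := e.piCDataOf ιC hιC`;
`Π_C̲̲ :=` a chosen open subgroup of type `(1, l-torsΘ)±` containing the given closed splitting `S`;
`Π^tp_C := M.GtpC`, `toHat := ιC` (injective: `hinj`), `Π^tp_Y := inclX(Ker toZ)`, `Π^tp_Ÿ := inclX(Π^tp_Ÿ)`,
`Π^tp_Ċ := dotC ε_Z` for a chosen admissible `ε_Z`. Binders: see the module docstring (P-C3/4/6/7).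
[cite: MochizukiEtTh2009, Def 2.3 p.38] -/
def temperedCoverData (e : M.CLevelData) (ιC : M.GtpC →ₜ* PC) (hιC : IsProfiniteCompletion ιC)
    (hinj : Function.Injective ιC) (op : M.toThetaSetting.OncePuncturedData) {l : ℕ} (hodd : Odd l)
    {x : M.Pt} (hx : M.IsCusp x)
    (hIx : ((e.piCDataOf ιC hιC).Dx x ⊓ (e.piCDataOf ιC hιC).augGK.ker) ⊔ (e.piCDataOf ιC hιC).barKer l =
      (e.piCDataOf ιC hιC).barTheta l)
    (hιell : ∀ c ∈ (e.piCDataOf ιC hιC).augGK.ker, c ∉ (e.piCDataOf ιC hιC).PiX →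
      ∀ d ∈ (e.piCDataOf ιC hιC).PiX ⊓ (e.piCDataOf ιC hιC).augGK.ker,
        c * d * c⁻¹ * d ∈ (e.piCDataOf ιC hιC).barTheta l)
    (hN : ((M.GtpXu l).map M.inclX).Normal) (hY : (M.GtpY.map M.inclX).Normal) {S : Subgroup PC}
    (hS : ((e.piCDataOf ιC hιC).coverDataAx l op hx hodd hIx hιell
        ((e.piCDataOf ιC hιC).inv_theta_of_inv_ell l op hιell)).toCoverData.IsSplitting S)
    (hSc : IsClosed (S : Set PC)) : TemperedCoverData.{0} l :=
  { (e.piCDataOf ιC hιC).coverDataAx l op hx hodd hIx hιell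
      ((e.piCDataOf ιC hιC).inv_theta_of_inv_ell l op hιell) with
    PiCuu := Classical.choose (e.exists_PiCuu_ofSetting' ιC hιC op hodd hx hIx hιell hN hS hSc)
    isTypeLTorsThetaPm :=
      (Classical.choose_spec (e.exists_PiCuu_ofSetting' ιC hιC op hodd hx hIx hιell hN hS hSc)).1
    isOpen_PiCuu' :=
      (Classical.choose_spec (e.exists_PiCuu_ofSetting' ιC hιC op hodd hx hIx hιell hN hS hSc)).2.1
    Gtp := M.GtpC
    toHat := ιC.toMonoidHom
    continuous_toHat := ιC.continuous
    injective_toHat := hinj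
    isProfiniteCompletion_toHat := hιC
    PiYtp := M.GtpY.map M.inclX
    PiYtp_le := map_inclX_GtpY_le ιC hιC _ (e.piCDataOf_incl_toHat ιC hιC)
    PiYtp_normal := hY
    isOpen_PiYtp := e.isOpen_map_inclX_GtpY
    quotZ := by
      haveI := hY
      exact nonempty_quot_map_inclX_GtpY_mulEquiv ιC hιC _ (e.piCDataOf_incl_toHat ιC hιC)
    PiYddtp := M.GtpYdd.map M.inclX
    PiYddtp_le := map_inclX_GtpYdd_le M
    isOpen_PiYddtp := e.isOpen_map_inclX_GtpYdd
    relIndex_PiYddtp := relIndex_map_inclX_GtpYdd M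
    PiCdot := M.dotC (Classical.choose M.exists_isAdmissibleEpsZ)
    index_PiCdot := M.index_dotC (Classical.choose_spec M.exists_isAdmissibleEpsZ)
    isOpen_PiCdot := e.isOpen_dotC _
    PiCdot_ne := dotC_ne_comap_range ιC hιC _ (e.piCDataOf_incl_toHat ιC hιC)
      (Classical.choose_spec M.exists_isAdmissibleEpsZ) }

/-- The underlying `CoverDataAx` of `temperedCoverData` IS abc-iut-L2-t10's `PiCData.coverDataAx` (rfl).
[cite: MochizukiEtTh2009, Def 2.1 p.36] -/
theorem temperedCoverData_toCoverDataAx (e : M.CLevelData) (ιC : M.GtpC →ₜ* PC)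
    (hιC : IsProfiniteCompletion ιC) (hinj : Function.Injective ιC) (op : M.toThetaSetting.OncePuncturedData)
    {l : ℕ} (hodd : Odd l) {x : M.Pt} (hx : M.IsCusp x)
    (hIx : ((e.piCDataOf ιC hιC).Dx x ⊓ (e.piCDataOf ιC hιC).augGK.ker) ⊔ (e.piCDataOf ιC hιC).barKer l =
      (e.piCDataOf ιC hιC).barTheta l)
    (hιell : ∀ c ∈ (e.piCDataOf ιC hιC).augGK.ker, c ∉ (e.piCDataOf ιC hιC).PiX →
      ∀ d ∈ (e.piCDataOf ιC hιC).PiX ⊓ (e.piCDataOf ιC hιC).augGK.ker,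
        c * d * c⁻¹ * d ∈ (e.piCDataOf ιC hιC).barTheta l)
    (hN : ((M.GtpXu l).map M.inclX).Normal) (hY : (M.GtpY.map M.inclX).Normal) {S : Subgroup PC}
    (hS : ((e.piCDataOf ιC hιC).coverDataAx l op hx hodd hIx hιell
        ((e.piCDataOf ιC hιC).inv_theta_of_inv_ell l op hιell)).toCoverData.IsSplitting S)
    (hSc : IsClosed (S : Set PC)) :
    (e.temperedCoverData ιC hιC hinj op hodd hx hIx hιell hN hY hS hSc).toCoverDataAx =
      (e.piCDataOf ιC hιC).coverDataAx l op hx hodd hIx hιell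
        ((e.piCDataOf ιC hιC).inv_theta_of_inv_ell l op hιell) := rfl

/-- `Π^tp_C`, `toHat`, `Π^tp_Y`, `Π^tp_Ÿ` of `temperedCoverData` are `M.GtpC`, `ιC`, `inclX(Π^tp_Y)`,
`inclX(Π^tp_Ÿ)` (rfl bookkeeping for consumers, e.g. abc-iut-L2-t2's `OrbitEmbedding`).
[cite: MochizukiEtTh2009, Prop 2.4 p.38] -/
theorem temperedCoverData_tempered (e : M.CLevelData) (ιC : M.GtpC →ₜ* PC)
    (hιC : IsProfiniteCompletion ιC) (hinj : Function.Injective ιC) (op : M.toThetaSetting.OncePuncturedData)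
    {l : ℕ} (hodd : Odd l) {x : M.Pt} (hx : M.IsCusp x)
    (hIx : ((e.piCDataOf ιC hιC).Dx x ⊓ (e.piCDataOf ιC hιC).augGK.ker) ⊔ (e.piCDataOf ιC hιC).barKer l =
      (e.piCDataOf ιC hιC).barTheta l)
    (hιell : ∀ c ∈ (e.piCDataOf ιC hιC).augGK.ker, c ∉ (e.piCDataOf ιC hιC).PiX →
      ∀ d ∈ (e.piCDataOf ιC hιC).PiX ⊓ (e.piCDataOf ιC hιC).augGK.ker,
        c * d * c⁻¹ * d ∈ (e.piCDataOf ιC hιC).barTheta l)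
    (hN : ((M.GtpXu l).map M.inclX).Normal) (hY : (M.GtpY.map M.inclX).Normal) {S : Subgroup PC}
    (hS : ((e.piCDataOf ιC hιC).coverDataAx l op hx hodd hIx hιell
        ((e.piCDataOf ιC hιC).inv_theta_of_inv_ell l op hιell)).toCoverData.IsSplitting S)
    (hSc : IsClosed (S : Set PC)) :
    (e.temperedCoverData ιC hιC hinj op hodd hx hIx hιell hN hY hS hSc).Gtp = M.GtpC ∧
      (e.temperedCoverData ιC hιC hinj op hodd hx hIx hιell hN hY hS hSc).toHat = ιC.toMonoidHom ∧
      (e.temperedCoverData ιC hιC hinj op hodd hx hIx hιell hN hY hS hSc).PiYtp = M.GtpY.map M.inclX ∧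
      (e.temperedCoverData ιC hιC hinj op hodd hx hIx hιell hN hY hS hSc).PiYddtp = M.GtpYdd.map M.inclX ∧
      S ≤ (e.temperedCoverData ιC hιC hinj op hodd hx hIx hιell hN hY hS hSc).PiCuu :=
  ⟨rfl, rfl, rfl, rfl,
    (Classical.choose_spec (e.exists_PiCuu_ofSetting' ιC hιC op hodd hx hIx hιell hN hS hSc)).2.2.1⟩

/-! ### v2: the `X̲`- and `X`-members of the assembled cover ARE print's coverings -/

/-- **`Π_X̲` of the assembled cover IS `cl(ιC(inclX(Π^tp_X̲)))`** — the covering of Def. 2.1 defined by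
`Π^tp_X ↠ Z ↠ Z/l` (v2 pin; `T.PiXu = (Π_C̲̲ ∩ Π_X)·Δ̄_Θ-preimage`). [cite: MochizukiEtTh2009, Def 2.1 p.36] -/
theorem temperedCoverData_PiXu (e : M.CLevelData) (ιC : M.GtpC →ₜ* PC)
    (hιC : IsProfiniteCompletion ιC) (hinj : Function.Injective ιC) (op : M.toThetaSetting.OncePuncturedData)
    {l : ℕ} (hodd : Odd l) {x : M.Pt} (hx : M.IsCusp x)
    (hIx : ((e.piCDataOf ιC hιC).Dx x ⊓ (e.piCDataOf ιC hιC).augGK.ker) ⊔ (e.piCDataOf ιC hιC).barKer l =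
      (e.piCDataOf ιC hιC).barTheta l)
    (hιell : ∀ c ∈ (e.piCDataOf ιC hιC).augGK.ker, c ∉ (e.piCDataOf ιC hιC).PiX →
      ∀ d ∈ (e.piCDataOf ιC hιC).PiX ⊓ (e.piCDataOf ιC hιC).augGK.ker,
        c * d * c⁻¹ * d ∈ (e.piCDataOf ιC hιC).barTheta l)
    (hN : ((M.GtpXu l).map M.inclX).Normal) (hY : (M.GtpY.map M.inclX).Normal) {S : Subgroup PC}
    (hS : ((e.piCDataOf ιC hιC).coverDataAx l op hx hodd hIx hιell
        ((e.piCDataOf ιC hιC).inv_theta_of_inv_ell l op hιell)).toCoverData.IsSplitting S)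
    (hSc : IsClosed (S : Set PC)) :
    (e.temperedCoverData ιC hιC hinj op hodd hx hIx hιell hN hY hS hSc).PiXu = (((M.GtpXu l).map M.inclX).map ιC.toMonoidHom).topologicalClosure :=
  (Classical.choose_spec (e.exists_PiCuu_ofSetting' ιC hιC op hodd hx hIx hιell hN hS hSc)).2.2.2

/-- **`Π^tp_X̲` of the assembled cover IS `inclX(Π^tp_X̲)`**: the `X̲`-member of the tempered tower of
Prop. 2.4 pulls back to abc-iut-L2-t7's `GtpXu` (`comap_closure_map_inclX`: an open finite-index subgroup
of `Π^tp_C` is the pull-back of its closure in a profinite completion). [cite: MochizukiEtTh2009, Prop 2.4 p.38] -/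
theorem temperedCoverData_tp_PiXu (e : M.CLevelData) (ιC : M.GtpC →ₜ* PC)
    (hιC : IsProfiniteCompletion ιC) (hinj : Function.Injective ιC) (op : M.toThetaSetting.OncePuncturedData)
    {l : ℕ} (hodd : Odd l) {x : M.Pt} (hx : M.IsCusp x)
    (hIx : ((e.piCDataOf ιC hιC).Dx x ⊓ (e.piCDataOf ιC hιC).augGK.ker) ⊔ (e.piCDataOf ιC hιC).barKer l =
      (e.piCDataOf ιC hιC).barTheta l)
    (hιell : ∀ c ∈ (e.piCDataOf ιC hιC).augGK.ker, c ∉ (e.piCDataOf ιC hιC).PiX →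
      ∀ d ∈ (e.piCDataOf ιC hιC).PiX ⊓ (e.piCDataOf ιC hιC).augGK.ker,
        c * d * c⁻¹ * d ∈ (e.piCDataOf ιC hιC).barTheta l)
    (hN : ((M.GtpXu l).map M.inclX).Normal) (hY : (M.GtpY.map M.inclX).Normal) {S : Subgroup PC}
    (hS : ((e.piCDataOf ιC hιC).coverDataAx l op hx hodd hIx hιell
        ((e.piCDataOf ιC hιC).inv_theta_of_inv_ell l op hιell)).toCoverData.IsSplitting S)
    (hSc : IsClosed (S : Set PC)) :
    (e.temperedCoverData ιC hιC hinj op hodd hx hIx hιell hN hY hS hSc).tp (e.temperedCoverData ιC hιC hinj op hodd hx hIx hιell hN hY hS hSc).PiXu = (M.GtpXu l).map M.inclX := by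
  haveI : NeZero l := ⟨by obtain ⟨k, hk⟩ := hodd; omega⟩
  haveI : (M.GtpXu l).FiniteIndex := ⟨by rw [M.index_GtpXu l]; exact NeZero.ne l⟩
  rw [TemperedCoverData.tp, temperedCoverData_PiXu]
  exact e.comap_closure_map_inclX ιC hιC _ (M.isOpen_GtpXu l)

/-- **Def. 2.5 (i)(a) HOLDS at the model**: "the quotient `Π̄_X ↠ Q` factors through `Π^tp_X ↠ Z`", i.e.
`Π^tp_Y ⊆ Π^tp_X̲` — the first conjunct of abc-iut-L2-t2's `Def25Conditions` for the assembled cover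
(`Π^tp_Y = Ker(toZ) ≤ toZ⁻¹(l·Z) = Π^tp_X̲`). [cite: MochizukiEtTh2009, Def 2.5(i) p.39] -/
theorem temperedCoverData_PiYtp_le_tp_PiXu (e : M.CLevelData) (ιC : M.GtpC →ₜ* PC)
    (hιC : IsProfiniteCompletion ιC) (hinj : Function.Injective ιC) (op : M.toThetaSetting.OncePuncturedData)
    {l : ℕ} (hodd : Odd l) {x : M.Pt} (hx : M.IsCusp x)
    (hIx : ((e.piCDataOf ιC hιC).Dx x ⊓ (e.piCDataOf ιC hιC).augGK.ker) ⊔ (e.piCDataOf ιC hιC).barKer l =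
      (e.piCDataOf ιC hιC).barTheta l)
    (hιell : ∀ c ∈ (e.piCDataOf ιC hιC).augGK.ker, c ∉ (e.piCDataOf ιC hιC).PiX →
      ∀ d ∈ (e.piCDataOf ιC hιC).PiX ⊓ (e.piCDataOf ιC hιC).augGK.ker,
        c * d * c⁻¹ * d ∈ (e.piCDataOf ιC hιC).barTheta l)
    (hN : ((M.GtpXu l).map M.inclX).Normal) (hY : (M.GtpY.map M.inclX).Normal) {S : Subgroup PC}
    (hS : ((e.piCDataOf ιC hιC).coverDataAx l op hx hodd hIx hιell
        ((e.piCDataOf ιC hιC).inv_theta_of_inv_ell l op hιell)).toCoverData.IsSplitting S)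
    (hSc : IsClosed (S : Set PC)) :
    (e.temperedCoverData ιC hιC hinj op hodd hx hIx hιell hN hY hS hSc).PiYtp ≤ (e.temperedCoverData ιC hιC hinj op hodd hx hIx hιell hN hY hS hSc).tp (e.temperedCoverData ιC hιC hinj op hodd hx hIx hιell hN hY hS hSc).PiXu := by
  rw [temperedCoverData_tp_PiXu]
  exact Subgroup.map_mono (M.GtpY_le_GtpXu l)

/-- **The assembled cover over THE completion `Π^tp_C ↪ Π_C := e.toPiCHat`** of `MuTwoSettingPiCData`
(`hinj := toPiCHat_injective`): `TemperedCoverData l` at the model with `Π_C` the profinite completion of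
record. [cite: MochizukiEtTh2009, Def 2.3 p.38] -/
def temperedCoverDataHat (e : M.CLevelData) (op : M.toThetaSetting.OncePuncturedData) {l : ℕ}
    (hodd : Odd l) {x : M.Pt} (hx : M.IsCusp x)
    (hIx : (e.piCData.Dx x ⊓ e.piCData.augGK.ker) ⊔ e.piCData.barKer l = e.piCData.barTheta l)
    (hιell : ∀ c ∈ e.piCData.augGK.ker, c ∉ e.piCData.PiX →
      ∀ d ∈ e.piCData.PiX ⊓ e.piCData.augGK.ker, c * d * c⁻¹ * d ∈ e.piCData.barTheta l)
    (hN : ((M.GtpXu l).map M.inclX).Normal) (hY : (M.GtpY.map M.inclX).Normal)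
    {S : Subgroup e.PiCHat}
    (hS : (e.piCData.coverDataAx l op hx hodd hIx hιell
        (e.piCData.inv_theta_of_inv_ell l op hιell)).toCoverData.IsSplitting S)
    (hSc : IsClosed (S : Set e.PiCHat)) : TemperedCoverData.{0} l :=
  e.temperedCoverData e.toPiCHat e.isProfiniteCompletion_toPiCHat e.toPiCHat_injective op hodd hx hIx hιell
    hN hY hS hSc

end MuTwoSetting.CLevelData

end Literature.AnabelianGeometry.EtaleTheta

end
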